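import Literature.NumberTheory.LFunctions.BurnolZetaSystemsMinimal
import HarnessLib

/-!
# Burnol 2004b, Thm. 6.3 (minimality half): the evaluators `Y¹_{ρ,k}` are a minimal system in `L_1`

LINE 1 — LABEL: RH-FREE (minimality of the system of evaluators of Burnol's space `L_1`, indexed by
the non-trivial zeros of `ζ` WHEREVER they lie). FRAMING (cell rh-crit, D-0074): corpus theorems are
RH-FREE literature; nothing here is worded as progress toward RH. bears_on: B-C/B-P (LADDER-RH
COLUMN 6, de Branges framework) as the minimality conjuncts of [Burnol2004b, Thm. 6.3]
(`Burnol2004b_thm6_3`) and the `a = 1` minimality case of Thm. 3.1. WHAT THIS IS NOT: not a route,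
not a criterion; nothing here bears on the truth of RH.

Source: J.-F. Burnol, JTNB 16 (2004) = arXiv:math/0203120v7, Thm. 6.3 and its proof, TeX of record
`dbl/src/Burnol2004JTNB_arXivmath0203120v7.tex` l.1259–1278: "The fact that the functions
`ζ(s)/(s−ρ)^l`, `1 ≤ l ≤ m_ρ` belong to `L̂_1` implies that the evaluators `Y¹_{ρ,k}`'s are a minimal
system. … The system of the `ζ(s)/(s−ρ)^l` is, up to triangular invertible linear combinations for
each `ρ`, the uniquely determined dual system. As a dual system it has to be minimal."

## What is proved (theorems only; no definition, no named fact)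

* `BurnolEvaluatorsMinimal.exists_leftPairingCLM` — `g ↦ [v, g] = ∫₀^∞ v g` is a continuous linear
  functional on `L²(ℝ)`;
* **`Burnol2004b_thm6_3_minimal_Y : IsMinimalSystem (burnolYSystem 1)`** — the evaluators
  `Y¹_{ρ,k}` are minimal in `L_1` (triangular inversion with the roles of the two systems exchanged:
  the functionals are the `[v_{ρ,l}, ·]`, the vectors the `Y¹_{ρ,k}`);
* `Burnol2004b_thm6_3_minimal` — both minimality conjuncts of `Burnol2004b_thm6_3`;
* `Burnol2004b_thm6_3_of : Burnol2004b_prop6_1 → Burnol2004b_cor5_3 → Burnol2004b_thm6_3` — Thm. 6.3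
  is now exactly its two completeness inputs away (Prop. 6.1 at `a = 1`: Kreĭn/Paley–Wiener; Cor. 5.3);
* `isMinimalSystem_burnolYSystem (ha : 0 < a) (ha1 : a ≤ 1)`, `Burnol2004b_prop6_4_minimal` (first
  conjunct of Prop. 6.4), `Burnol2004b_thm3_1_minimal_of_le_one` (the "`a ≤ 1` ⇒ minimal" half of
  Thm. 3.1's first clause) — via `L_1 ⊆ L_a` (`sonineL_antitone`) the same dual functionals work.

## References

* J.-F. Burnol, JTNB 16 (2004), Thm. 6.3 (arXiv:math/0203120v7 p. 16, TeX l.1259–1278). [key `Burnol2004b`]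
-/

noncomputable section

open MeasureTheory Complex Filter Set Real
open scoped Topology

namespace Literature.NumberTheory.LFunctions

namespace BurnolEvaluatorsMinimal

open BurnolZetaHardy BurnolEvaluators BurnolZetaDuality BurnolZetaMinimal

/-- **`g ↦ [v, g] = ∫₀^∞ v·g` is a continuous linear functional on `L²(ℝ)`.**
[cite: Burnol2004b, §2 (arXiv:math/0203120v7 p. 5, TeX l.477–481)] -/
theorem exists_leftPairingCLM (v : Lp ℂ 2 (volume : Measure ℝ)) :
    ∃ T : Lp ℂ 2 (volume : Measure ℝ) →L[ℂ] ℂ,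
      ∀ g : Lp ℂ 2 (volume : Measure ℝ), T g = ∫ t in Ioi (0 : ℝ), v t * g t := by
  obtain ⟨T, hT⟩ := exists_pairingCLM v
  refine ⟨T, fun g ↦ ?_⟩
  rw [hT]
  exact integral_congr_ae (Eventually.of_forall fun t ↦ mul_comm _ _)

/-- **Thm. 6.3, minimality of the evaluators**: the system `(Y¹_{ρ,k})`, `ρ` a non-trivial zero,
`0 ≤ k < m_ρ`, is MINIMAL in `L_1`. For the index `(ρ, k₀)` the triangular inversion
(`BurnolZetaMinimal.exists_dual_functional`) applied to the continuous functionals `[v_{ρ,l}, ·]`,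
`1 ≤ l ≤ m_ρ`, and the vectors `Y¹_{ρ,k}`, `k < m_ρ` (`[v_{ρ,l}, Y¹_{ρ,k}] = 0` for `k + l < m_ρ`, `≠ 0`
for `k + l = m_ρ`) gives `ψ` with `ψ(Y¹_{ρ,k₀}) ≠ 0`, `ψ(Y¹_{ρ,k}) = 0` (`k ≠ k₀`), and `ψ(Y¹_{ρ″,k}) = 0`
for `ρ″ ≠ ρ` (every `[v_{ρ,l}, Y¹_{ρ″,k}]`, `k < m_{ρ″}`, vanishes); `ψ` is continuous and kills the
closed span of the other evaluators. [cite: Burnol2004b, Thm. 6.3 and its proof (arXiv:math/0203120v7 p. 16, TeX l.1259–1278)] -/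
theorem Burnol2004b_thm6_3_minimal_Y : IsMinimalSystem (burnolYSystem 1) := by
  intro q₀ hmem
  obtain ⟨⟨ρ, k₀⟩, hρ, hk₀⟩ := q₀
  simp only at hρ hk₀ hmem
  set m := (riemannZetaZeroOrder ρ).toNat with hm
  have hk₀m : k₀ + 1 ≤ m := by omega
  -- the functionals `[v_{ρ,i+1}, ·]`, `i ∈ ℕ`
  choose T hT using fun i : ℕ ↦ exists_leftPairingCLM (zetaQuotientVector ρ (i + 1))
  -- vectors `w_j = Y¹_{ρ,j-1}`, `1 ≤ j ≤ m`
  have h0 : ∀ i j, 1 ≤ j → j ≤ m → i + j < m → T i (burnolY 1 ρ (j - 1)) = 0 := by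
    intro i j hj hjm hij
    rw [hT]
    exact pairing_vector_self_eq_zero hρ (l := i + 1) (by omega) (by omega) (by omega)
  have h1 : ∀ i j, 1 ≤ j → j ≤ m → i + j = m → T i (burnolY 1 ρ (j - 1)) ≠ 0 := by
    intro i j hj hjm hij
    rw [hT]
    exact pairing_vector_self_ne_zero hρ (l := i + 1) (by omega) (by omega) (by omega)
  obtain ⟨ψ, hψ0, hψ1, hψ2⟩ :=
    exists_dual_functional T (fun j ↦ burnolY 1 ρ (j - 1)) m h0 h1 (k₀ + 1) (by omega) hk₀m
  simp only [Nat.add_sub_cancel] at hψ0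
  -- `ψ` kills every other evaluator
  have hker : ∀ r : ZetaZeroIndex, r ≠ ⟨(ρ, k₀), hρ, hk₀⟩ → ψ (burnolYSystem 1 r) = 0 := by
    intro r hr
    obtain ⟨⟨ρr, kr⟩, hρr, hkr⟩ := r
    show ψ (burnolY 1 ρr kr) = 0
    by_cases heq : ρr = ρ
    · subst heq
      have hne : kr + 1 ≠ k₀ + 1 := by
        intro h
        apply hr
        have : kr = k₀ := by omega
        subst this
        rfl
      have h := hψ1 (kr + 1) (by omega) (by simp only at hkr; omega) hne
      simpa only [Nat.add_sub_cancel] using h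
    · refine hψ2 _ fun i hi ↦ ?_
      rw [hT]
      exact pairing_vector_of_ne_eq_zero hρ (l := i + 1) (by omega) (by push_cast; omega) hρr heq
        (by simp only at hkr ⊢; omega)
  -- the closed span of the others lies in `ker ψ`
  have hspan : (Submodule.span ℂ (burnolYSystem 1 '' {j | j ≠ ⟨(ρ, k₀), hρ, hk₀⟩}) :
      Set (Lp ℂ 2 (volume : Measure ℝ))) ⊆ {x | ψ x = 0} := by
    have : Submodule.span ℂ (burnolYSystem 1 '' {j | j ≠ ⟨(ρ, k₀), hρ, hk₀⟩}) ≤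
        LinearMap.ker (ψ : Lp ℂ 2 (volume : Measure ℝ) →ₗ[ℂ] ℂ) := by
      refine Submodule.span_le.2 ?_
      rintro x ⟨r, hr, rfl⟩
      exact hker r hr
    intro x hx
    exact this hx
  have hcl : closure (Submodule.span ℂ (burnolYSystem 1 '' {j | j ≠ ⟨(ρ, k₀), hρ, hk₀⟩}) :
      Set (Lp ℂ 2 (volume : Measure ℝ))) ⊆ {x | ψ x = 0} :=
    closure_minimal hspan (isClosed_singleton.preimage ψ.continuous)
  exact hψ0 (hcl hmem)

/-- **Both minimality conjuncts of Thm. 6.3.** [cite: Burnol2004b, Thm. 6.3 (arXiv:math/0203120v7 p. 16, TeX l.1259–1278)] -/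
theorem Burnol2004b_thm6_3_minimal :
    IsMinimalSystem (burnolYSystem 1) ∧ IsMinimalSystem zetaQuotientSystem :=
  ⟨Burnol2004b_thm6_3_minimal_Y, Burnol2004b_thm3_3_ii⟩

/-- **Thm. 6.3 from its completeness inputs**: with both minimality conjuncts proved, the typed
Thm. 6.3 follows from the completeness of the `Y¹_{ρ,k}` in `L_1` (Prop. 6.1 at `a = 1`, "We know
already that they are a complete system") and of the `ζ(s)/(s−ρ)^l` (Cor. 5.3, "we know already from
5.3 that it is a complete system"). [cite: Burnol2004b, Thm. 6.3 and its proof (arXiv:math/0203120v7 p. 16, TeX l.1259–1278)] -/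
theorem Burnol2004b_thm6_3_of (h61 : Burnol2004b_prop6_1) (h53 : Burnol2004b_cor5_3) :
    Burnol2004b_thm6_3 :=
  ⟨⟨Burnol2004b_thm6_3_minimal_Y, h61 1 le_rfl⟩, ⟨Burnol2004b_thm3_3_ii, h53⟩⟩

/-! ## F. Minimality of the evaluators `Y^a_{ρ,k}` in `L_a` for every `0 < a ≤ 1` -/

/-- `L_b ⊆ L_a` for `a ≤ b` (constancy on the longer interval `(0,b)` implies constancy on `(0,a)`).
[cite: Burnol2004b, §2 (arXiv:math/0203120v7 p. 5, TeX l.413–423)] -/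
theorem sonineL_antitone {a b : ℝ} (hab : a ≤ b) : sonineL b ⊆ sonineL a := by
  rintro f ⟨he, ⟨c, hc⟩, ⟨c', hc'⟩⟩
  exact ⟨he, ⟨c, hc.mono fun x hx hxa ↦ hx ⟨hxa.1, hxa.2.trans_le hab⟩⟩,
    ⟨c', hc'.mono fun x hx hxa ↦ hx ⟨hxa.1, hxa.2.trans_le hab⟩⟩⟩

/-- **`[v_{ρ,l}, Y^a_{ρ′,k}] = (d/ds)^k[Γ_ℝ(s)ζ(s)/(s−ρ)^l]_{s=ρ′}` for every `0 < a ≤ 1`**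
(`v_{ρ,l} ∈ L_1 ⊆ L_a`, and `Y^a_{ρ′,k}` evaluates `M(·)^{(k)}(ρ′)` on `L_a`) — "their orthogonal
projections to `L_1` are the `Y¹_{ρ,k}`". [cite: Burnol2004b, Prop. 6.4 and its proof (arXiv:math/0203120v7 p. 16, TeX l.1282–1292)] -/
theorem pairing_vector_eq_iteratedDeriv_of_le_one {a : ℝ} (ha : 0 < a) (ha1 : a ≤ 1) {ρ ρ' : ℂ}
    (hρ : ρ ∈ ZetaZeros.riemannZetaNontrivialZeros) {l : ℕ} (hl : 1 ≤ l)
    (hlm : (l : ℤ) ≤ riemannZetaZeroOrder ρ) (hρ' : ρ' ∈ ZetaZeros.riemannZetaNontrivialZeros) (k : ℕ) :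
    ∫ t in Ioi (0 : ℝ), zetaQuotientVector ρ l t * burnolY a ρ' k t =
      iteratedDeriv k (fun s ↦ Gammaℝ s * zetaOverPow ρ l s) ρ' := by
  obtain ⟨h0, h1, hn⟩ := admissible_of_mem_nontrivialZeros hρ'
  have hv := isZetaQuotientVector_zetaQuotientVector hρ hl hlm
  rw [(isBurnolY_burnolY ha h0 h1 hn k).2 _ (sonineL_antitone ha1 hv.1)]
  simp only [burnolEval]
  apply Filter.EventuallyEq.iteratedDeriv_eq
  filter_upwards [isOpen_ne.mem_nhds h1] with s hs
  simp only [completedMellin]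
  rw [rightMellinExt_zetaQuotientVector hρ hl hlm hs]

/-- For `0 < a ≤ 1` the pairings `[v_{ρ,l}, Y^a_{ρ′,k}]` coincide with the `a = 1` ones.
[cite: Burnol2004b, Prop. 6.4 and its proof (arXiv:math/0203120v7 p. 16, TeX l.1282–1292)] -/
theorem pairing_vector_eq_pairing_one {a : ℝ} (ha : 0 < a) (ha1 : a ≤ 1) {ρ ρ' : ℂ}
    (hρ : ρ ∈ ZetaZeros.riemannZetaNontrivialZeros) {l : ℕ} (hl : 1 ≤ l)
    (hlm : (l : ℤ) ≤ riemannZetaZeroOrder ρ) (hρ' : ρ' ∈ ZetaZeros.riemannZetaNontrivialZeros) (k : ℕ) :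
    ∫ t in Ioi (0 : ℝ), zetaQuotientVector ρ l t * burnolY a ρ' k t =
      ∫ t in Ioi (0 : ℝ), zetaQuotientVector ρ l t * burnolY 1 ρ' k t := by
  rw [pairing_vector_eq_iteratedDeriv_of_le_one ha ha1 hρ hl hlm hρ' k,
    pairing_vector_eq_iteratedDeriv hρ hl hlm hρ' k]

/-- **Minimality of the evaluators `Y^a_{ρ,k}` in `L_a` for every `0 < a ≤ 1`** (Thm. 6.3 for `a = 1`,
the minimality clause of Prop. 6.4 for `a < 1`: "their orthogonal projections to `L_1` are the
`Y¹_{ρ,k}`" — the dual functionals `[v_{ρ,l}, ·]`, `v_{ρ,l} ∈ L_1 ⊆ L_a`, see the `Y^a_{ρ,k}` exactly as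
they see the `Y¹_{ρ,k}`). [cite: Burnol2004b, Thm. 6.3 and Prop. 6.4 (arXiv:math/0203120v7 p. 16, TeX l.1259–1292)] -/
theorem isMinimalSystem_burnolYSystem {a : ℝ} (ha : 0 < a) (ha1 : a ≤ 1) :
    IsMinimalSystem (burnolYSystem a) := by
  intro q₀ hmem
  obtain ⟨⟨ρ, k₀⟩, hρ, hk₀⟩ := q₀
  simp only at hρ hk₀ hmem
  set m := (riemannZetaZeroOrder ρ).toNat with hm
  have hk₀m : k₀ + 1 ≤ m := by omega
  choose T hT using fun i : ℕ ↦ exists_leftPairingCLM (zetaQuotientVector ρ (i + 1))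
  have h0 : ∀ i j, 1 ≤ j → j ≤ m → i + j < m → T i (burnolY a ρ (j - 1)) = 0 := by
    intro i j hj hjm hij
    rw [hT, pairing_vector_eq_pairing_one ha ha1 hρ (l := i + 1) (by omega) (by push_cast; omega) hρ]
    exact pairing_vector_self_eq_zero hρ (l := i + 1) (by omega) (by omega) (by omega)
  have h1 : ∀ i j, 1 ≤ j → j ≤ m → i + j = m → T i (burnolY a ρ (j - 1)) ≠ 0 := by
    intro i j hj hjm hij
    rw [hT, pairing_vector_eq_pairing_one ha ha1 hρ (l := i + 1) (by omega) (by push_cast; omega) hρ]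
    exact pairing_vector_self_ne_zero hρ (l := i + 1) (by omega) (by omega) (by omega)
  obtain ⟨ψ, hψ0, hψ1, hψ2⟩ :=
    exists_dual_functional T (fun j ↦ burnolY a ρ (j - 1)) m h0 h1 (k₀ + 1) (by omega) hk₀m
  simp only [Nat.add_sub_cancel] at hψ0
  have hker : ∀ r : ZetaZeroIndex, r ≠ ⟨(ρ, k₀), hρ, hk₀⟩ → ψ (burnolYSystem a r) = 0 := by
    intro r hr
    obtain ⟨⟨ρr, kr⟩, hρr, hkr⟩ := r
    show ψ (burnolY a ρr kr) = 0
    by_cases heq : ρr = ρ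
    · subst heq
      have hne : kr + 1 ≠ k₀ + 1 := by
        intro h
        apply hr
        have : kr = k₀ := by omega
        subst this
        rfl
      have h := hψ1 (kr + 1) (by omega) (by simp only at hkr; omega) hne
      simpa only [Nat.add_sub_cancel] using h
    · refine hψ2 _ fun i hi ↦ ?_
      rw [hT, pairing_vector_eq_pairing_one ha ha1 hρ (l := i + 1) (by omega) (by push_cast; omega)
        hρr]
      exact pairing_vector_of_ne_eq_zero hρ (l := i + 1) (by omega) (by push_cast; omega) hρr heq
        (by simp only at hkr ⊢; omega)
  have hspan : (Submodule.span ℂ (burnolYSystem a '' {j | j ≠ ⟨(ρ, k₀), hρ, hk₀⟩}) :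
      Set (Lp ℂ 2 (volume : Measure ℝ))) ⊆ {x | ψ x = 0} := by
    have : Submodule.span ℂ (burnolYSystem a '' {j | j ≠ ⟨(ρ, k₀), hρ, hk₀⟩}) ≤
        LinearMap.ker (ψ : Lp ℂ 2 (volume : Measure ℝ) →ₗ[ℂ] ℂ) := by
      refine Submodule.span_le.2 ?_
      rintro x ⟨r, hr, rfl⟩
      exact hker r hr
    intro x hx
    exact this hx
  have hcl : closure (Submodule.span ℂ (burnolYSystem a '' {j | j ≠ ⟨(ρ, k₀), hρ, hk₀⟩}) :
      Set (Lp ℂ 2 (volume : Measure ℝ))) ⊆ {x | ψ x = 0} :=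
    closure_minimal hspan (isClosed_singleton.preimage ψ.continuous)
  exact hψ0 (hcl hmem)

/-- **Prop. 6.4, minimality clause** (first conjunct of `Burnol2004b_prop6_4 a`, verbatim): for
`0 < a < 1` the `Y^a_{ρ,k}` are a minimal system. [cite: Burnol2004b, Prop. 6.4 (arXiv:math/0203120v7 p. 16, TeX l.1282–1292)] -/
theorem Burnol2004b_prop6_4_minimal : ∀ a : ℝ, 0 < a → a < 1 → IsMinimalSystem (burnolYSystem a) :=
  fun _ ha ha1 ↦ isMinimalSystem_burnolYSystem ha ha1.le

/-- **Thm. 3.1, the direction "`a ≤ 1` ⇒ the `Y^a_{ρ,k}` are minimal in `L_a`"** (the `←` half of the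
first conjunct of `Burnol2004b_thm3_1 a`). [cite: Burnol2004b, Thm. 3.1 (arXiv:math/0203120v7 p. 6, TeX l.516–525)] -/
theorem Burnol2004b_thm3_1_minimal_of_le_one :
    ∀ a : ℝ, 0 < a → a ≤ 1 → IsMinimalSystem (burnolYSystem a) :=
  fun _ ha ha1 ↦ isMinimalSystem_burnolYSystem ha ha1

end BurnolEvaluatorsMinimal

end Literature.NumberTheory.LFunctions

end
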